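import Summits.QuantumFields.YangMills.Theorems.BalabanUVNodesSpineRatesHolder
import Summits.QuantumFields.YangMills.Theorems.BalabanUVNodesN17AtSpineCarriers
import Summits.QuantumFields.YangMills.Theorems.BalabanUVNodesRateCarriersOfRecord13CoPHOn

/-!
# BalabanUVNodes ∕ node N17 = NE4 — THE N17 GLUE IN THE R-β ∕ ARBITRARY-READING CURRENCY AT THE STAGE-13 `CoPH` KEYS, BY NAME:
# `RatesHolderAt D R β` (dag-n16-e 41ᴴ) and the K3⁷ v2 rates-predicate body `RatesHolderAt D R β ∧ ReadOutAt D R.u3` FROM THE FIVE PRODUCER FACES AND THE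
# (D4) READ-OUT — N17 DERIVED (`YMDAG.N17.n17At_of_readOutAt`), never assumed — At-level and θ-keyed over `(θ : Node00.Stage13HParams F N) (hP : θ.Provisos₁₃CoPH F N)`

Cell `pub-ymgap` (HUMAN RULING D-0062 Track A; director-ym №197 ∕ HUMAN RULING D-0149 width seats).  PROVENANCE: §1–§3 = the farm-clean draft of seat `pub-ymgap-dag-n17-w3`
(WIDTH SEAT 3∕3 on NODE n17, generation 0; sha16 da6a055696cad6f9, INTENT-1 pub-ymgap INBOX l.24237, WITHDRAWN l.24439 on plan g78's word W-SEAT-START-LIST v4 §n17 item 3 «the N17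
glue successor stays the n27-c lineage's» and parked as an OFFER at HOME `pub-ymgap-dag-n17-w3/lean/…lean.draft`) taken VERBATIM; §4 and the filing = R134 seat `pub-ymgap-dag-n27-c`
(N27 B5 composite, s2) generation 11 — the composer lineage that CONSUMES the glue (leaf D `…N27SpineGivenEndpointR13SepCoPHKeyedCore` p578137, (Q) `…N27AtRecord13CoPHHolder` p581033).
`--kind proof --supports stmt-QuantumFields-20544 --as helper` (K3⁷ `Theses.BalabanUVNodes.SpineGivenEndpointR13SepCoPH`; COUNT-NEUTRAL).  THEOREMS ONLY: 0 `def`, 0 `sorry`,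
standard axioms; imports dag-n16-e 41ᴴ `…SpineRatesHolder` (p573254: `RatesHolderAt`, `RateInputsHolder`, `RateInputsAllHolder`), dag-n17-a `…N17AtSpineCarriers` (p421092:
`YMDAG.N17.n17At_of_readOutAt`, `ratesAt_of_readOutAt`) and dag-n22-e 5″ᶜᵒᵖᴴ `…RateCarriersOfRecord13CoPHOn` (`RRec₁₃CoPHOn`, `rRec₁₃CoPHOn_self`, `rateCarriersOfRecord₁₃CoPH`; it re-exports
node00-def-T FILE 27 `Node00/Record13CoPH` p537939: `Stage13HParams`, `Provisos₁₃CoPH`, `datumOfRecord₁₃CoPH`); modifies nothing; every cited lemma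
used BY NAME; nothing landed is re-declared (dag-n17-c's Stage13Params-keyed §67ᶜᵒᴾ `n17_keyed₁₃CoP_of_readOut_keyed` ∕ `ratesAt_keyed₁₃CoP_of_five_glueN17` of `…N17AtRecord13CoPKeys`
p523886 are the MODEL; they bind `θ : Stage13Params` with `Provisos₁₃Core` and cannot be applied at a `Stage13HParams ∕ Provisos₁₃CoPH` reading — hence this file).

WHY.  Under the K3⁷ skeleton v2 DRAFT (plan g77 `D77-K3V2-draft`, sha16 4ed2af5f6ac4aa4f) the rates predicate is `PHolderD4 β D R := RatesHolderAt D R β ∧ ReadOutAt D R.u3`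
and the rate reading is keyed `(F : T4Family) → (θ : Stage13HParams F 2) → θ.Provisos₁₃CoPH F 2 → (ℕ → ℝ) → List (ULoop F) → RateCarriers 2`; dag-n27-c's leaf D
`…N27SpineGivenEndpointR13SepCoPHKeyedCore` (p578137) concludes the item from such a reading at an ARBITRARY rates predicate `P` (`…_of_keyedFacesP`), bundled
(`…_of_keyedFacesRatesHolder`, binder `hrates : … RatesHolderAt … β`) or face by face (`…_of_keyedFacesHolder`, binders `h14 h15 h16 h17 h18 h22`).  Node N17 is
DEPENDENT (dag-lead NODE-TABLE row n17 «NOTHING TO HUNT»; plan W-SEAT-START-LIST v3 §2: «N17 DERIVED from (D4) ∧ N18 ∧ N22 — NOT a w-target»): its face is OWED BY NO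
PRODUCER — it follows from the (D4) read-out binders and N18 = NE5 at the same U3 carriers by the kernel edge `YMDAG.N17.n17At_of_readOutAt` (N22 idle).  This file is
that glue in the four shapes a leaf-D ∕ v2-skeleton ∕ (Q)-storey consumer meets: At-level at exponent `β` (§1), θ-keyed at the CoPH datum for an arbitrary reading and
guard (§2), at the item's literal guard (§3), and at the regime-restricted HOME `RRec₁₃CoPHOn 𝔯 Rg` of a Stage-13 `CoPH` rate reading from the K4 SENTENCES there (§4).

WHAT IS KERNEL-CHECKED ([bookkeeping]; `N`-generic, `β` a free letter — the consumers' window `2∕3 < β < 1` is theirs):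
* §1 `ratesHolderAt_of_readOutAt` — `N14At R.ne1 → N15At R.ne2 → N16HolderAt R.ne3 β → ReadOutAt D R.u3 → N18At R.u3 → N22At R.u3 → RatesHolderAt D R β` (41ᴴ has the
  `RatesAt`-road `ratesHolderAt_of_ratesAt` only; dag-n17-a the β = 1 `ratesAt_of_readOutAt` only); `ratesHolderAt_and_readOutAt_of_faces` (the v2 body at the carriers);
  `rateInputsHolder_of_readOutAt` (41ᴴ's ∃-packaged hook `RateInputsHolder RRec β` witnessed by one bundle of record carrying the five faces + (D4)).
* §2 θ-KEYED AT `datumOfRecord₁₃CoPH F N θ hP`, arbitrary reading `rr`, arbitrary guard `P F θ hP` (the item's guard `θ.ZhUnity F N ∧ θ.SlotsNondegenerate₁₃ F N` followed by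
  `θ.Admissible F N`, or any prefix; the glue never reads `P`): `n17_keyed₁₃CoPH_of_readOut_keyed` (leaf D `…_of_keyedFacesHolder`'s `h17` slot from its would-be `hD4` + `h18`),
  `ratesHolderAt_keyed₁₃CoPH_of_five_glueN17` (leaf D `…_of_keyedFacesRatesHolder`'s `hrates` from the five keyed faces + keyed (D4)),
  `ratesHolderAt_and_readOutAt_keyed₁₃CoPH_of_five` (the v2 `KeyedRatesHolderD4`-shaped hypothesis — body SPELLED `RatesHolderAt … β ∧ ReadOutAt …`, the draft is not a
  tree module and is not imported).
* §3 the same three at the item's literal guard shape `(θ.ZhUnity F N ∧ θ.SlotsNondegenerate₁₃ F N) → θ.Admissible F N → …` (two-binder form, as leaf D displays it):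
  `n17_guarded₁₃CoPH_of_readOut`, `ratesHolderAt_guarded₁₃CoPH_of_five_glueN17`, `ratesHolderAt_and_readOutAt_guarded₁₃CoPH_of_five`.
* §4 (namespace `YMDAG.UVSplit`, the R-β ∕ (D4) twins of dag-n22-e 5″ᶜᵒᵖᴴ §5 `ratesAt_of_k4_rRec₁₃CoPHOn` ∕ `exists_keyedRates_window_of_k4_rRec₁₃CoPHOn_true_glueN17`) AT THE
  REGIME-RESTRICTED HOME `RRec₁₃CoPHOn 𝔯 Rg` of ANY Stage-13 `CoPH` rate reading `𝔯` (e.g. dag-n22-e's reading of record `readingOfRecord₁₃CoPH w1 ℓ₃ ne2 ne1`), any regime `Rg`: from the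
  K4 SENTENCES `S_N14 ∕ S_N15 ∕ S_N16Holder β ∕ S_N18 ∕ S_N22 ∕ S_D4` there (the hypotheses (Q) §1∕§2 and every N27 `…Holder…` storey display; `S_N17` glued, or kept in the
  `…_holder` variant) — `ratesHolderAt_of_k4_rRec₁₃CoPHOn_holder` · `ratesHolderAt_and_readOutAt_of_k4_rRec₁₃CoPHOn_holder_glueN17` (at EVERY run length `k` of the reading at every
  admissible tuple with provisos in `Rg`, on its datum: `RatesHolderAt … β ∧ ReadOutAt …` — the `∀ k` antecedent of (Q)'s `h19` and, at `k := ksel …`, the v2 body) ·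
  `rateInputsAllHolder_rRec₁₃CoPHOn_of_k4_glueN17` (41ᴴ's ∀-hook at the home) · ★ `exists_keyedRatesHolderD4_of_k4_rRec₁₃CoPHOn_glueN17 (ksel)` («∃ rr, (∀ F θ hP, Rg F θ →
  θ.Admissible F N → ∀ g₀ os, RatesHolderAt (datumOfRecord₁₃CoPH F N θ hP) (rr F θ hP g₀ os) β ∧ ReadOutAt … (rr F θ hP g₀ os).u3) ∧ (rr …).u3.γ = θ.γ» with the witness `rr :=` the
  level-selected home reading `fun F θ hP g₀ os => rateCarriersOfRecord₁₃CoPH 𝔯 F θ hP g₀ os (ksel F θ hP g₀ os)` = the v2 draft's `rrOfRecord 𝔯 ksel`; at `N = 2`, `Rg F θ := θ.ZhUnity F 2 ∧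
  θ.SlotsNondegenerate₁₃ F 2` the first conjunct is `KeyedRatesHolderD4 β (rrOfRecord 𝔯 ksel)` UNFOLDED — `stub_rates13H`'s matrix for THAT `𝔯`, the junction only) ·
  `exists_keyedRatesHolderD4_of_k4_rRec₁₃CoPHOn_unityNondeg_glueN17` (the guard-of-record instance `Rg := Node00.unityNondeg₁₃H N`).

HONEST FRAMING.  Kernel bookkeeping BY NAME over typed SHAPES; every rate face and the (D4) read-out are HYPOTHESES (inhabited for no family today — K0⁷ OPEN); NE4 is NOT
IN PRINT ([Balaban1987RG1] p. 264 «We will investigate other properties in a separate paper», (1.20)–(1.22); p. 298) and NOT PROVED; (D4) ∕ NE5 ∕ NE9 ∕ NE3-at-exponent-β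
NOT PROVED; nothing of Bałaban's asserted or instantiated; N17 composite (max of N15, N16, (D4)), NOT discharged; K3⁷ OPEN, NOT claimed; the skeleton of record and every
landed declaration UNTOUCHED (additive file); counts UNMOVED (typed 28∕28 · discharged 5∕27, A 5∕28).  One finite four-torus programme at fixed `ε` per run — R4 closes the
conditional rung `BalabanLadder.UV` only; NOT ℝ⁴, NOT infinite volume, NOT OS, NOT a mass gap, NOT Clay.  No `instance`, no `notation`.
-/

set_option autoImplicit false

namespace YMDAG.N17

open Literature.MathematicalPhysics.QuantumFieldTheory.Balaban1983to89
open Literature.MathematicalPhysics.QuantumFieldTheory.Balaban1983to89.T4Continuum (T4Family ULoop)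
open Literature.MathematicalPhysics.QuantumFieldTheory.Balaban1983to89.Node00 (Stage13HParams datumOfRecord₁₃CoPH)
open YMDAG.UVSplit
open Summit.QuantumFields.YangMills.BalabanUVNodes.N16HolderDefs (N16HolderAt)
open Summit.QuantumFields.YangMills.BalabanUVNodes.SpineRatesHolder (RatesHolderAt RateInputsHolder)

variable {N : ℕ} [NeZero N]

/-! ## §1 At-level: K4's β-conclusion for ONE string from the five producer faces and the (D4) read-out (N17 derived) -/

section OnDatum

variable {F : T4Family}

/-- **`RatesHolderAt D R β` FROM THE FIVE PRODUCERS AND (D4)** — N14, N15, N16 at exponent `β` at their carriers, the (D4) β-read-out binders, N18, N22 at node U3's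
carriers ⟹ dag-n16-e's β-twin of K4's per-string conclusion; the N17 conjunct is `YMDAG.N17.n17At_of_readOutAt D hD4 h18` (the U3 → U2 edge, N22 idle for N17 proper).
The R-β twin of dag-n17-a's `ratesAt_of_readOutAt`.  Every input UNPRINTED — binders. [bookkeeping] [cite: Balaban1987RG1, (1.20)-(1.22) p.264] -/
theorem ratesHolderAt_of_readOutAt {D : Datum F N} {R : RateCarriers N} {β : ℝ} (h14 : N14At R.ne1) (h15 : N15At R.ne2)
    (h16 : N16HolderAt R.ne3 β) (hD4 : ReadOutAt D R.u3) (h18 : N18At R.u3) (h22 : N22At R.u3) : RatesHolderAt D R β :=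
  ⟨h14, h15, h16, n17At_of_readOutAt D hD4 h18, h18, h22⟩

/-- **THE K3⁷ v2 RATES-PREDICATE BODY AT THE CARRIERS** — `RatesHolderAt D R β ∧ ReadOutAt D R.u3` (plan g77 draft `PHolderD4 β D R`, spelled) from the same six inputs:
the (D4) binder is USED for N17 and KEPT as the second conjunct. [bookkeeping] [cite: Balaban1987RG1, (1.20)-(1.22) p.264] -/
theorem ratesHolderAt_and_readOutAt_of_faces {D : Datum F N} {R : RateCarriers N} {β : ℝ} (h14 : N14At R.ne1) (h15 : N15At R.ne2)
    (h16 : N16HolderAt R.ne3 β) (hD4 : ReadOutAt D R.u3) (h18 : N18At R.u3) (h22 : N22At R.u3) :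
    RatesHolderAt D R β ∧ ReadOutAt D R.u3 :=
  ⟨ratesHolderAt_of_readOutAt h14 h15 h16 hD4 h18 h22, hD4⟩

/-- Conversely the body's first conjunct already carries N17 (fourth slot) — nothing is lost by deriving it. [bookkeeping] -/
theorem n17At_of_ratesHolderAt {D : Datum F N} {R : RateCarriers N} {β : ℝ} (h : RatesHolderAt D R β) : N17At D R.u3 :=
  h.2.2.2.1

/-- **41ᴴ's ∃-PACKAGED β-HOOK FROM ONE BUNDLE OF RECORD** carrying the five producer faces and (D4): `RateInputsHolder RRec β F D g₀ os`
(`SpineRatesHolder.rateInputsHolder_iff`). [bookkeeping] -/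
theorem rateInputsHolder_of_readOutAt (RRec : RateRecordPred N) {β : ℝ} {D : Datum F N} {g₀ : ℕ → ℝ} {os : List (ULoop F)}
    {R : RateCarriers N} (hR : RRec F D g₀ os R) (h14 : N14At R.ne1) (h15 : N15At R.ne2) (h16 : N16HolderAt R.ne3 β)
    (hD4 : ReadOutAt D R.u3) (h18 : N18At R.u3) (h22 : N22At R.u3) : RateInputsHolder RRec β F D g₀ os :=
  ⟨R, hR, ratesHolderAt_of_readOutAt h14 h15 h16 hD4 h18 h22⟩

end OnDatum

/-! ## §2 θ-keyed at the Stage-13 `CoPH` datum of record — arbitrary reading `rr`, arbitrary guard `P` (leaf D's binder shapes) -/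

section KeyedGlue

variable (P : (F : T4Family) → (θ : Stage13HParams F N) → θ.Provisos₁₃CoPH F N → Prop)
variable (rr : (F : T4Family) → (θ : Stage13HParams F N) → θ.Provisos₁₃CoPH F N → (ℕ → ℝ) → List (ULoop F) → RateCarriers N)

/-- **THE KEYED N17 FACE FROM THE KEYED (D4) AND N18 FACES, Stage-13 `CoPH` keys, ANY GUARD `P`** (the glue never reads `P`): at every tuple under the guard and every
`g₀, os`, the (D4) read-out binders at `(datumOfRecord₁₃CoPH F N θ hP, (rr F θ hP g₀ os).u3)` and N18 = NE5 at `(rr F θ hP g₀ os).u3` ⟹ N17 there — pointwise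
`YMDAG.N17.n17At_of_readOutAt`.  This is the `h17` slot of dag-n27-c's leaf D `spineGivenEndpointR13SepCoPH_of_keyedFacesHolder` from its neighbours; the CoPH twin of
dag-n17-c's `n17_keyed₁₃CoP_of_readOut_keyed`.  (D4) and NE5 UNPRINTED — binders. [bookkeeping] [cite: Balaban1987RG1, (1.20)-(1.22) p.264] -/
theorem n17_keyed₁₃CoPH_of_readOut_keyed
    (hD4 : ∀ (F : T4Family) (θ : Stage13HParams F N) (hP : θ.Provisos₁₃CoPH F N), P F θ hP → ∀ (g₀ : ℕ → ℝ) (os : List (ULoop F)),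
      ReadOutAt (datumOfRecord₁₃CoPH F N θ hP) (rr F θ hP g₀ os).u3)
    (h18 : ∀ (F : T4Family) (θ : Stage13HParams F N) (hP : θ.Provisos₁₃CoPH F N), P F θ hP → ∀ (g₀ : ℕ → ℝ) (os : List (ULoop F)),
      N18At (rr F θ hP g₀ os).u3)
    (F : T4Family) (θ : Stage13HParams F N) (hP : θ.Provisos₁₃CoPH F N) (hθ : P F θ hP) (g₀ : ℕ → ℝ) (os : List (ULoop F)) :
    N17At (datumOfRecord₁₃CoPH F N θ hP) (rr F θ hP g₀ os).u3 :=
  n17At_of_readOutAt _ (hD4 F θ hP hθ g₀ os) (h18 F θ hP hθ g₀ os)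

/-- **`RatesHolderAt … β` AT THE KEYED READING FROM THE FIVE KEYED FACES AND THE KEYED (D4), any guard `P`** (N17 GLUED, not assumed): N14 · N15 · N16 at exponent `β`
(`N16HolderAt (rr …).ne3 β`, dag-n16-c) · N18 · N22 at `rr F θ hP g₀ os` and the (D4) read-out on the datum of record ⟹ dag-n16-e's `RatesHolderAt (datumOfRecord₁₃CoPH F N θ hP)
(rr F θ hP g₀ os) β` under the same guard — the `hrates` binder of leaf D `spineGivenEndpointR13SepCoPH_of_keyedFacesRatesHolder`, and the first conjunct of the v2 draft's
`KeyedRatesHolderD4`. [bookkeeping] [cite: Balaban1987RG1, (1.20)-(1.22) p.264] -/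
theorem ratesHolderAt_keyed₁₃CoPH_of_five_glueN17 {β : ℝ}
    (h14 : ∀ (F : T4Family) (θ : Stage13HParams F N) (hP : θ.Provisos₁₃CoPH F N), P F θ hP → ∀ (g₀ : ℕ → ℝ) (os : List (ULoop F)),
      N14At (rr F θ hP g₀ os).ne1)
    (h15 : ∀ (F : T4Family) (θ : Stage13HParams F N) (hP : θ.Provisos₁₃CoPH F N), P F θ hP → ∀ (g₀ : ℕ → ℝ) (os : List (ULoop F)),
      N15At (rr F θ hP g₀ os).ne2)
    (h16 : ∀ (F : T4Family) (θ : Stage13HParams F N) (hP : θ.Provisos₁₃CoPH F N), P F θ hP → ∀ (g₀ : ℕ → ℝ) (os : List (ULoop F)),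
      N16HolderAt (rr F θ hP g₀ os).ne3 β)
    (h18 : ∀ (F : T4Family) (θ : Stage13HParams F N) (hP : θ.Provisos₁₃CoPH F N), P F θ hP → ∀ (g₀ : ℕ → ℝ) (os : List (ULoop F)),
      N18At (rr F θ hP g₀ os).u3)
    (h22 : ∀ (F : T4Family) (θ : Stage13HParams F N) (hP : θ.Provisos₁₃CoPH F N), P F θ hP → ∀ (g₀ : ℕ → ℝ) (os : List (ULoop F)),
      N22At (rr F θ hP g₀ os).u3)
    (hD4 : ∀ (F : T4Family) (θ : Stage13HParams F N) (hP : θ.Provisos₁₃CoPH F N), P F θ hP → ∀ (g₀ : ℕ → ℝ) (os : List (ULoop F)),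
      ReadOutAt (datumOfRecord₁₃CoPH F N θ hP) (rr F θ hP g₀ os).u3)
    (F : T4Family) (θ : Stage13HParams F N) (hP : θ.Provisos₁₃CoPH F N) (hθ : P F θ hP) (g₀ : ℕ → ℝ) (os : List (ULoop F)) :
    RatesHolderAt (datumOfRecord₁₃CoPH F N θ hP) (rr F θ hP g₀ os) β :=
  ratesHolderAt_of_readOutAt (h14 F θ hP hθ g₀ os) (h15 F θ hP hθ g₀ os) (h16 F θ hP hθ g₀ os) (hD4 F θ hP hθ g₀ os)
    (h18 F θ hP hθ g₀ os) (h22 F θ hP hθ g₀ os)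

/-- **THE v2 RATES-PREDICATE BODY, KEYED, FROM THE SAME SIX** (any guard `P`): `RatesHolderAt (datumOfRecord₁₃CoPH F N θ hP) (rr F θ hP g₀ os) β ∧
ReadOutAt (datumOfRecord₁₃CoPH F N θ hP) (rr F θ hP g₀ os).u3` — the shape of the draft's `KeyedRatesHolderD4 β rr` at guard `P`; a `stub_rates13H`-type prover owes N17 NOTHING
beyond (D4) and NE5 at its own reading. [bookkeeping] [cite: Balaban1987RG1, (1.20)-(1.22) p.264] -/
theorem ratesHolderAt_and_readOutAt_keyed₁₃CoPH_of_five {β : ℝ}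
    (h14 : ∀ (F : T4Family) (θ : Stage13HParams F N) (hP : θ.Provisos₁₃CoPH F N), P F θ hP → ∀ (g₀ : ℕ → ℝ) (os : List (ULoop F)),
      N14At (rr F θ hP g₀ os).ne1)
    (h15 : ∀ (F : T4Family) (θ : Stage13HParams F N) (hP : θ.Provisos₁₃CoPH F N), P F θ hP → ∀ (g₀ : ℕ → ℝ) (os : List (ULoop F)),
      N15At (rr F θ hP g₀ os).ne2)
    (h16 : ∀ (F : T4Family) (θ : Stage13HParams F N) (hP : θ.Provisos₁₃CoPH F N), P F θ hP → ∀ (g₀ : ℕ → ℝ) (os : List (ULoop F)),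
      N16HolderAt (rr F θ hP g₀ os).ne3 β)
    (h18 : ∀ (F : T4Family) (θ : Stage13HParams F N) (hP : θ.Provisos₁₃CoPH F N), P F θ hP → ∀ (g₀ : ℕ → ℝ) (os : List (ULoop F)),
      N18At (rr F θ hP g₀ os).u3)
    (h22 : ∀ (F : T4Family) (θ : Stage13HParams F N) (hP : θ.Provisos₁₃CoPH F N), P F θ hP → ∀ (g₀ : ℕ → ℝ) (os : List (ULoop F)),
      N22At (rr F θ hP g₀ os).u3)
    (hD4 : ∀ (F : T4Family) (θ : Stage13HParams F N) (hP : θ.Provisos₁₃CoPH F N), P F θ hP → ∀ (g₀ : ℕ → ℝ) (os : List (ULoop F)),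
      ReadOutAt (datumOfRecord₁₃CoPH F N θ hP) (rr F θ hP g₀ os).u3)
    (F : T4Family) (θ : Stage13HParams F N) (hP : θ.Provisos₁₃CoPH F N) (hθ : P F θ hP) (g₀ : ℕ → ℝ) (os : List (ULoop F)) :
    RatesHolderAt (datumOfRecord₁₃CoPH F N θ hP) (rr F θ hP g₀ os) β ∧ ReadOutAt (datumOfRecord₁₃CoPH F N θ hP) (rr F θ hP g₀ os).u3 :=
  ⟨ratesHolderAt_keyed₁₃CoPH_of_five_glueN17 P rr h14 h15 h16 h18 h22 hD4 F θ hP hθ g₀ os, hD4 F θ hP hθ g₀ os⟩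

end KeyedGlue

/-! ## §3 The same at the item's literal guard shape `(θ.ZhUnity F N ∧ θ.SlotsNondegenerate₁₃ F N) → θ.Admissible F N → …` (leaf D's two-binder display) -/

section Guarded

variable (rr : (F : T4Family) → (θ : Stage13HParams F N) → θ.Provisos₁₃CoPH F N → (ℕ → ℝ) → List (ULoop F) → RateCarriers N)

/-- **THE `h17` SLOT OF LEAF D `…_of_keyedFacesHolder` FROM ITS `hD4`-SHAPED AND `h18` NEIGHBOURS**, at the item's guard literally (two binders: the guard conjunction, then
admissibility) — §2 at `P F θ hP := (θ.ZhUnity F N ∧ θ.SlotsNondegenerate₁₃ F N) ∧ θ.Admissible F N`, re-curried. [bookkeeping] [cite: Balaban1987RG1, (1.20)-(1.22) p.264] -/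
theorem n17_guarded₁₃CoPH_of_readOut
    (hD4 : ∀ (F : T4Family) (θ : Stage13HParams F N) (hP : θ.Provisos₁₃CoPH F N), (θ.ZhUnity F N ∧ θ.SlotsNondegenerate₁₃ F N) → θ.Admissible F N →
      ∀ (g₀ : ℕ → ℝ) (os : List (ULoop F)), ReadOutAt (datumOfRecord₁₃CoPH F N θ hP) (rr F θ hP g₀ os).u3)
    (h18 : ∀ (F : T4Family) (θ : Stage13HParams F N) (hP : θ.Provisos₁₃CoPH F N), (θ.ZhUnity F N ∧ θ.SlotsNondegenerate₁₃ F N) → θ.Admissible F N →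
      ∀ (g₀ : ℕ → ℝ) (os : List (ULoop F)), N18At (rr F θ hP g₀ os).u3) :
    ∀ (F : T4Family) (θ : Stage13HParams F N) (hP : θ.Provisos₁₃CoPH F N), (θ.ZhUnity F N ∧ θ.SlotsNondegenerate₁₃ F N) → θ.Admissible F N →
      ∀ (g₀ : ℕ → ℝ) (os : List (ULoop F)), N17At (datumOfRecord₁₃CoPH F N θ hP) (rr F θ hP g₀ os).u3 :=
  fun F θ hP hG hθ g₀ os => n17At_of_readOutAt _ (hD4 F θ hP hG hθ g₀ os) (h18 F θ hP hG hθ g₀ os)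

/-- **LEAF D `…_of_keyedFacesRatesHolder`'s `hrates` BINDER FROM THE FIVE GUARDED FACES + GUARDED (D4)** (N16 at exponent `β`; N17 glued). [bookkeeping]
[cite: Balaban1987RG1, (1.20)-(1.22) p.264] -/
theorem ratesHolderAt_guarded₁₃CoPH_of_five_glueN17 {β : ℝ}
    (h14 : ∀ (F : T4Family) (θ : Stage13HParams F N) (hP : θ.Provisos₁₃CoPH F N), (θ.ZhUnity F N ∧ θ.SlotsNondegenerate₁₃ F N) → θ.Admissible F N →
      ∀ (g₀ : ℕ → ℝ) (os : List (ULoop F)), N14At (rr F θ hP g₀ os).ne1)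
    (h15 : ∀ (F : T4Family) (θ : Stage13HParams F N) (hP : θ.Provisos₁₃CoPH F N), (θ.ZhUnity F N ∧ θ.SlotsNondegenerate₁₃ F N) → θ.Admissible F N →
      ∀ (g₀ : ℕ → ℝ) (os : List (ULoop F)), N15At (rr F θ hP g₀ os).ne2)
    (h16 : ∀ (F : T4Family) (θ : Stage13HParams F N) (hP : θ.Provisos₁₃CoPH F N), (θ.ZhUnity F N ∧ θ.SlotsNondegenerate₁₃ F N) → θ.Admissible F N →
      ∀ (g₀ : ℕ → ℝ) (os : List (ULoop F)), N16HolderAt (rr F θ hP g₀ os).ne3 β)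
    (h18 : ∀ (F : T4Family) (θ : Stage13HParams F N) (hP : θ.Provisos₁₃CoPH F N), (θ.ZhUnity F N ∧ θ.SlotsNondegenerate₁₃ F N) → θ.Admissible F N →
      ∀ (g₀ : ℕ → ℝ) (os : List (ULoop F)), N18At (rr F θ hP g₀ os).u3)
    (h22 : ∀ (F : T4Family) (θ : Stage13HParams F N) (hP : θ.Provisos₁₃CoPH F N), (θ.ZhUnity F N ∧ θ.SlotsNondegenerate₁₃ F N) → θ.Admissible F N →
      ∀ (g₀ : ℕ → ℝ) (os : List (ULoop F)), N22At (rr F θ hP g₀ os).u3)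
    (hD4 : ∀ (F : T4Family) (θ : Stage13HParams F N) (hP : θ.Provisos₁₃CoPH F N), (θ.ZhUnity F N ∧ θ.SlotsNondegenerate₁₃ F N) → θ.Admissible F N →
      ∀ (g₀ : ℕ → ℝ) (os : List (ULoop F)), ReadOutAt (datumOfRecord₁₃CoPH F N θ hP) (rr F θ hP g₀ os).u3) :
    ∀ (F : T4Family) (θ : Stage13HParams F N) (hP : θ.Provisos₁₃CoPH F N), (θ.ZhUnity F N ∧ θ.SlotsNondegenerate₁₃ F N) → θ.Admissible F N →
      ∀ (g₀ : ℕ → ℝ) (os : List (ULoop F)), RatesHolderAt (datumOfRecord₁₃CoPH F N θ hP) (rr F θ hP g₀ os) β :=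
  fun F θ hP hG hθ g₀ os => ratesHolderAt_of_readOutAt (h14 F θ hP hG hθ g₀ os) (h15 F θ hP hG hθ g₀ os) (h16 F θ hP hG hθ g₀ os)
    (hD4 F θ hP hG hθ g₀ os) (h18 F θ hP hG hθ g₀ os) (h22 F θ hP hG hθ g₀ os)

/-- **THE v2 `KeyedRatesHolderD4`-SHAPED HYPOTHESIS AT THE ITEM's GUARD FROM THE SAME SIX** — body `RatesHolderAt … β ∧ ReadOutAt …` spelled. [bookkeeping]
[cite: Balaban1987RG1, (1.20)-(1.22) p.264] -/
theorem ratesHolderAt_and_readOutAt_guarded₁₃CoPH_of_five {β : ℝ}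
    (h14 : ∀ (F : T4Family) (θ : Stage13HParams F N) (hP : θ.Provisos₁₃CoPH F N), (θ.ZhUnity F N ∧ θ.SlotsNondegenerate₁₃ F N) → θ.Admissible F N →
      ∀ (g₀ : ℕ → ℝ) (os : List (ULoop F)), N14At (rr F θ hP g₀ os).ne1)
    (h15 : ∀ (F : T4Family) (θ : Stage13HParams F N) (hP : θ.Provisos₁₃CoPH F N), (θ.ZhUnity F N ∧ θ.SlotsNondegenerate₁₃ F N) → θ.Admissible F N →
      ∀ (g₀ : ℕ → ℝ) (os : List (ULoop F)), N15At (rr F θ hP g₀ os).ne2)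
    (h16 : ∀ (F : T4Family) (θ : Stage13HParams F N) (hP : θ.Provisos₁₃CoPH F N), (θ.ZhUnity F N ∧ θ.SlotsNondegenerate₁₃ F N) → θ.Admissible F N →
      ∀ (g₀ : ℕ → ℝ) (os : List (ULoop F)), N16HolderAt (rr F θ hP g₀ os).ne3 β)
    (h18 : ∀ (F : T4Family) (θ : Stage13HParams F N) (hP : θ.Provisos₁₃CoPH F N), (θ.ZhUnity F N ∧ θ.SlotsNondegenerate₁₃ F N) → θ.Admissible F N →
      ∀ (g₀ : ℕ → ℝ) (os : List (ULoop F)), N18At (rr F θ hP g₀ os).u3)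
    (h22 : ∀ (F : T4Family) (θ : Stage13HParams F N) (hP : θ.Provisos₁₃CoPH F N), (θ.ZhUnity F N ∧ θ.SlotsNondegenerate₁₃ F N) → θ.Admissible F N →
      ∀ (g₀ : ℕ → ℝ) (os : List (ULoop F)), N22At (rr F θ hP g₀ os).u3)
    (hD4 : ∀ (F : T4Family) (θ : Stage13HParams F N) (hP : θ.Provisos₁₃CoPH F N), (θ.ZhUnity F N ∧ θ.SlotsNondegenerate₁₃ F N) → θ.Admissible F N →
      ∀ (g₀ : ℕ → ℝ) (os : List (ULoop F)), ReadOutAt (datumOfRecord₁₃CoPH F N θ hP) (rr F θ hP g₀ os).u3) :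
    ∀ (F : T4Family) (θ : Stage13HParams F N) (hP : θ.Provisos₁₃CoPH F N), (θ.ZhUnity F N ∧ θ.SlotsNondegenerate₁₃ F N) → θ.Admissible F N →
      ∀ (g₀ : ℕ → ℝ) (os : List (ULoop F)),
        RatesHolderAt (datumOfRecord₁₃CoPH F N θ hP) (rr F θ hP g₀ os) β ∧ ReadOutAt (datumOfRecord₁₃CoPH F N θ hP) (rr F θ hP g₀ os).u3 :=
  fun F θ hP hG hθ g₀ os => ⟨ratesHolderAt_guarded₁₃CoPH_of_five_glueN17 rr h14 h15 h16 h18 h22 hD4 F θ hP hG hθ g₀ os, hD4 F θ hP hG hθ g₀ os⟩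

end Guarded

end YMDAG.N17

/-! ## §4 (dag-n27-c g11) At the regime-restricted HOME of a Stage-13 `CoPH` rate reading: the β-rates with (D4) from the K4 SENTENCES there (R-β ∕ (D4) twins of
dag-n22-e 5″ᶜᵒᵖᴴ §5), and the K3⁷ v2 draft's `stub_rates13H` matrix for that reading -/

namespace YMDAG.UVSplit

open Literature.MathematicalPhysics.QuantumFieldTheory.Balaban1983to89
open Literature.MathematicalPhysics.QuantumFieldTheory.Balaban1983to89.T4Continuum
open Node00 (Stage13HParams datumOfRecord₁₃CoPH)
open Summit.QuantumFields.YangMills.BalabanUVNodes.N16HolderDefs (N16HolderAt S_N16Holder)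
open Summit.QuantumFields.YangMills.BalabanUVNodes.SpineRatesHolder (RatesHolderAt RateInputsAllHolder)

variable {N : ℕ} [NeZero N] (𝔯 : RateReading₁₃CoPH N) (Rg : (F : T4Family) → Stage13HParams F N → Prop)

/-- **THE SIX K4 SENTENCES AT THE REGIME HOME, N16 AT EXPONENT `β`, GIVE `RatesHolderAt … β` AT EVERY RUN LENGTH OF THE READING ON ITS DATUM** — the R-β twin of dag-n22-e
5″ᶜᵒᵖᴴ `ratesAt_of_k4_rRec₁₃CoPHOn` (`S_N16 ↦ S_N16Holder β`, `RatesAt ↦ RatesHolderAt … β`; `rRec₁₃CoPHOn_self`).  N17 ASSUMED here (`h17`); glued below.  Every sentence a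
HYPOTHESIS (0∕1 today). [bookkeeping] -/
theorem ratesHolderAt_of_k4_rRec₁₃CoPHOn_holder {β : ℝ} (h14 : S_N14 (RRec₁₃CoPHOn 𝔯 Rg)) (h15 : S_N15 (RRec₁₃CoPHOn 𝔯 Rg))
    (h16 : S_N16Holder β (RRec₁₃CoPHOn 𝔯 Rg)) (h17 : S_N17 (RRec₁₃CoPHOn 𝔯 Rg)) (h18 : S_N18 (RRec₁₃CoPHOn 𝔯 Rg)) (h22 : S_N22 (RRec₁₃CoPHOn 𝔯 Rg))
    (F : T4Family) (θ : Stage13HParams F N) (hP : θ.Provisos₁₃CoPH F N) (hRg : Rg F θ) (hθ : θ.Admissible F N) (g₀ : ℕ → ℝ) (os : List (ULoop F)) (k : ℕ) :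
    RatesHolderAt (datumOfRecord₁₃CoPH F N θ hP) (rateCarriersOfRecord₁₃CoPH 𝔯 F θ hP g₀ os k) β :=
  have hR := rRec₁₃CoPHOn_self 𝔯 Rg θ hP hRg hθ g₀ os k
  ⟨h14 F _ g₀ os _ hR, h15 F _ g₀ os _ hR, h16 F _ g₀ os _ hR, h17 F _ g₀ os _ hR, h18 F _ g₀ os _ hR, h22 F _ g₀ os _ hR⟩

/-- ★ **THE FIVE PRODUCER SENTENCES AND THE (D4) SENTENCE AT THE REGIME HOME GIVE `RatesHolderAt … β ∧ ReadOutAt …` AT EVERY RUN LENGTH OF THE READING ON ITS DATUM — N17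
GLUED** (§1 `YMDAG.N17.ratesHolderAt_and_readOutAt_of_faces` at the bundle pinned by `rRec₁₃CoPHOn_self`): for every family, every admissible Stage-13 tuple with provisos IN
`Rg`, every `g₀, os, k`.  The `∀ k`-form is the antecedent dag-n27-c (Q) `…N27AtRecord13CoPHHolder` §1∕§2's `h19` reads; at a run-length selector `k := ksel F θ hP g₀ os` it is the
K3⁷ v2 draft's rates-predicate body `PHolderD4 β` at `rrOfRecord 𝔯 ksel` (below).  (D4) ∕ NE1′ ∕ NE2 ∕ NE3-at-β ∕ NE5 ∕ NE9 NOT PROVED — sentences displayed. [bookkeeping] -/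
theorem ratesHolderAt_and_readOutAt_of_k4_rRec₁₃CoPHOn_holder_glueN17 {β : ℝ} (h14 : S_N14 (RRec₁₃CoPHOn 𝔯 Rg)) (h15 : S_N15 (RRec₁₃CoPHOn 𝔯 Rg))
    (h16 : S_N16Holder β (RRec₁₃CoPHOn 𝔯 Rg)) (h18 : S_N18 (RRec₁₃CoPHOn 𝔯 Rg)) (h22 : S_N22 (RRec₁₃CoPHOn 𝔯 Rg)) (hD4 : S_D4 (RRec₁₃CoPHOn 𝔯 Rg))
    (F : T4Family) (θ : Stage13HParams F N) (hP : θ.Provisos₁₃CoPH F N) (hRg : Rg F θ) (hθ : θ.Admissible F N) (g₀ : ℕ → ℝ) (os : List (ULoop F)) (k : ℕ) :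
    RatesHolderAt (datumOfRecord₁₃CoPH F N θ hP) (rateCarriersOfRecord₁₃CoPH 𝔯 F θ hP g₀ os k) β ∧
      ReadOutAt (datumOfRecord₁₃CoPH F N θ hP) (rateCarriersOfRecord₁₃CoPH 𝔯 F θ hP g₀ os k).u3 :=
  have hR := rRec₁₃CoPHOn_self 𝔯 Rg θ hP hRg hθ g₀ os k
  YMDAG.N17.ratesHolderAt_and_readOutAt_of_faces (h14 F _ g₀ os _ hR) (h15 F _ g₀ os _ hR) (h16 F _ g₀ os _ hR) (hD4 F _ g₀ os _ hR)
    (h18 F _ g₀ os _ hR) (h22 F _ g₀ os _ hR)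

/-- **dag-n16-e 41ᴴ's ∀-HOOK AT THE REGIME HOME FROM THE FIVE SENTENCES + (D4)**: `RateInputsAllHolder (RRec₁₃CoPHOn 𝔯 Rg) β F D g₀ os` at every `(F, D, g₀, os)` — every bundle the
home pins carries the β-rates (N17 glued).  What (Q) §1 `coreEdge_of_homes₁₃CoPHOn_holder`'s `hin` asks. [bookkeeping] -/
theorem rateInputsAllHolder_rRec₁₃CoPHOn_of_k4_glueN17 {β : ℝ} (h14 : S_N14 (RRec₁₃CoPHOn 𝔯 Rg)) (h15 : S_N15 (RRec₁₃CoPHOn 𝔯 Rg))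
    (h16 : S_N16Holder β (RRec₁₃CoPHOn 𝔯 Rg)) (h18 : S_N18 (RRec₁₃CoPHOn 𝔯 Rg)) (h22 : S_N22 (RRec₁₃CoPHOn 𝔯 Rg)) (hD4 : S_D4 (RRec₁₃CoPHOn 𝔯 Rg))
    (F : T4Family) (D : Datum F N) (g₀ : ℕ → ℝ) (os : List (ULoop F)) : RateInputsAllHolder (RRec₁₃CoPHOn 𝔯 Rg) β F D g₀ os := by
  rintro R ⟨θ, hP, hRg, hθ, rfl, k, rfl⟩
  exact (ratesHolderAt_and_readOutAt_of_k4_rRec₁₃CoPHOn_holder_glueN17 𝔯 Rg h14 h15 h16 h18 h22 hD4 F θ hP hRg hθ g₀ os k).1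

/-- ★★ **THE K3⁷ v2 DRAFT's `stub_rates13H` MATRIX FOR A GIVEN STAGE-13 RATE READING, FROM THE SENTENCES AT ITS REGIME HOME** (the R-β ∕ (D4) twin of dag-n22-e 5″ᶜᵒᵖᴴ
`exists_keyedRates_window_of_k4_rRec₁₃CoPHOn_true_glueN17`; `N`-generic, ANY regime, ANY run-length selector `ksel`): the five producer sentences and the (D4) sentence at
`RRec₁₃CoPHOn 𝔯 Rg` give a SINGLE-BUNDLE tuple reading `rr` carrying, at every admissible tuple with provisos in `Rg`, every `g₀, os`, `RatesHolderAt (datumOfRecord₁₃CoPH F N θ hP)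
(rr F θ hP g₀ os) β ∧ ReadOutAt (datumOfRecord₁₃CoPH F N θ hP) (rr F θ hP g₀ os).u3`, and whose U3 window radius IS the record's `θ.γ` (`rfl`) — WITNESS the level-selected home
reading `rr F θ hP g₀ os := rateCarriersOfRecord₁₃CoPH 𝔯 F θ hP g₀ os (ksel F θ hP g₀ os)`, i.e. plan g77's `rrOfRecord 𝔯 ksel` (`D77-K3V2-draft/K3Skeleton13SepCoPHV2.draft.lean`
4ed2af5f6ac4aa4f, NOT a tree module, NOT imported — bodies SPELLED).  At `N = 2`, `Rg F θ := θ.ZhUnity F 2 ∧ θ.SlotsNondegenerate₁₃ F 2` the first conjunct is the draft's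
`KeyedRatesHolderD4 β (rrOfRecord 𝔯 ksel)` unfolded (`PHolderD4 β D R := RatesHolderAt D R β ∧ ReadOutAt D R.u3`); the draft's outer `∃ β, 2∕3 < β ∧ β < 1 ∧ ∃ 𝔯 ksel, …` and
the (q1)(q2) pins of `𝔯` are the stub prover's ∕ the plan's.  THE JUNCTION ONLY — the six sentences stay the nodes' estimates (0∕1 today); nothing of Bałaban's asserted;
K3⁷ OPEN. [bookkeeping] -/
theorem exists_keyedRatesHolderD4_of_k4_rRec₁₃CoPHOn_glueN17 {β : ℝ}
    (ksel : (F : T4Family) → (θ : Stage13HParams F N) → θ.Provisos₁₃CoPH F N → (ℕ → ℝ) → List (ULoop F) → ℕ)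
    (h14 : S_N14 (RRec₁₃CoPHOn 𝔯 Rg)) (h15 : S_N15 (RRec₁₃CoPHOn 𝔯 Rg)) (h16 : S_N16Holder β (RRec₁₃CoPHOn 𝔯 Rg)) (h18 : S_N18 (RRec₁₃CoPHOn 𝔯 Rg))
    (h22 : S_N22 (RRec₁₃CoPHOn 𝔯 Rg)) (hD4 : S_D4 (RRec₁₃CoPHOn 𝔯 Rg)) :
    ∃ rr : (F : T4Family) → (θ : Stage13HParams F N) → θ.Provisos₁₃CoPH F N → (ℕ → ℝ) → List (ULoop F) → RateCarriers N,
      (∀ (F : T4Family) (θ : Stage13HParams F N) (hP : θ.Provisos₁₃CoPH F N), Rg F θ → θ.Admissible F N → ∀ (g₀ : ℕ → ℝ) (os : List (ULoop F)),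
          RatesHolderAt (datumOfRecord₁₃CoPH F N θ hP) (rr F θ hP g₀ os) β ∧ ReadOutAt (datumOfRecord₁₃CoPH F N θ hP) (rr F θ hP g₀ os).u3) ∧
        ∀ (F : T4Family) (θ : Stage13HParams F N) (hP : θ.Provisos₁₃CoPH F N) (g₀ : ℕ → ℝ) (os : List (ULoop F)), (rr F θ hP g₀ os).u3.γ = θ.γ :=
  ⟨fun F θ hP g₀ os => rateCarriersOfRecord₁₃CoPH 𝔯 F θ hP g₀ os (ksel F θ hP g₀ os),
    fun F θ hP hRg hθ g₀ os => ratesHolderAt_and_readOutAt_of_k4_rRec₁₃CoPHOn_holder_glueN17 𝔯 Rg h14 h15 h16 h18 h22 hD4 F θ hP hRg hθ g₀ os _,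
    fun _ _ _ _ _ => rfl⟩

/-- **… AT THE GUARD-OF-RECORD HOME** `RRec₁₃CoPHOn 𝔯 (Node00.unityNondeg₁₃H N)` (node00-def-RR-2's guard `θ.ZhUnity F N ∧ θ.SlotsNondegenerate₁₃ F N` — at `N = 2` the item's and the
v2 draft's literal binder prefix «`(θ.ZhUnity F 2 ∧ θ.SlotsNondegenerate₁₃ F 2) → θ.Admissible F 2 → …`»). [bookkeeping] -/
theorem exists_keyedRatesHolderD4_of_k4_rRec₁₃CoPHOn_unityNondeg_glueN17 {β : ℝ}
    (ksel : (F : T4Family) → (θ : Stage13HParams F N) → θ.Provisos₁₃CoPH F N → (ℕ → ℝ) → List (ULoop F) → ℕ)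
    (h14 : S_N14 (RRec₁₃CoPHOn 𝔯 (Node00.unityNondeg₁₃H N))) (h15 : S_N15 (RRec₁₃CoPHOn 𝔯 (Node00.unityNondeg₁₃H N)))
    (h16 : S_N16Holder β (RRec₁₃CoPHOn 𝔯 (Node00.unityNondeg₁₃H N))) (h18 : S_N18 (RRec₁₃CoPHOn 𝔯 (Node00.unityNondeg₁₃H N)))
    (h22 : S_N22 (RRec₁₃CoPHOn 𝔯 (Node00.unityNondeg₁₃H N))) (hD4 : S_D4 (RRec₁₃CoPHOn 𝔯 (Node00.unityNondeg₁₃H N))) :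
    ∃ rr : (F : T4Family) → (θ : Stage13HParams F N) → θ.Provisos₁₃CoPH F N → (ℕ → ℝ) → List (ULoop F) → RateCarriers N,
      (∀ (F : T4Family) (θ : Stage13HParams F N) (hP : θ.Provisos₁₃CoPH F N), (θ.ZhUnity F N ∧ θ.SlotsNondegenerate₁₃ F N) → θ.Admissible F N →
          ∀ (g₀ : ℕ → ℝ) (os : List (ULoop F)),
            RatesHolderAt (datumOfRecord₁₃CoPH F N θ hP) (rr F θ hP g₀ os) β ∧ ReadOutAt (datumOfRecord₁₃CoPH F N θ hP) (rr F θ hP g₀ os).u3) ∧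
        ∀ (F : T4Family) (θ : Stage13HParams F N) (hP : θ.Provisos₁₃CoPH F N) (g₀ : ℕ → ℝ) (os : List (ULoop F)), (rr F θ hP g₀ os).u3.γ = θ.γ :=
  exists_keyedRatesHolderD4_of_k4_rRec₁₃CoPHOn_glueN17 𝔯 _ ksel h14 h15 h16 h18 h22 hD4

end YMDAG.UVSplit
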